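import Literature.AnabelianGeometry.EtaleTheta.LogDivisorModelTateTowerKummerTwistRootLaw
import Literature.AnabelianGeometry.EtaleTheta.Discharge.Sec4GaloisLiftOfFullEssSurj

/-!
# [SemiAnbd] Def. 3.1 (i) for the compatible ζ-twisted Kummer–Tate group: `Ẑ(1)² ⋊ Ẑˣ × ℤ_γ` IS a tempered group; hence the
# `IG := «Galois»` form of A10 over the ζ-twisted tower with E2 (a) AND temperedness discharged

S. Mochizuki, *Semi-graphs of anabelioids*, Publ. RIMS **42** (2006) [MochizukiSemiAnbd2006], §3 Def. 3.1 (i) p.33 («may be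
written as an inverse limit of an inverse system of surjections of countable discrete topological groups»); S. Mochizuki,
*The étale theta function …* [MochizukiEtTh2009], §4 Def. 4.1 (ii) p.86, Prop. 4.2 (iii) p.89
[cite: MochizukiSemiAnbd2006, Def 3.1 (i) p.33].

abc-iut cell, layer L2, seat abc-iut-L2-d2 (gen 6); L2-lead R677/R689/R722 «ζ-TWISTED KUMMER TOWER» — the `isTempered` item of
piece (d); sequel to `…KummerTwistRootLaw.lean`; the analogue of abc-iut-w6-d058's `LogDivisorModelTateTowerKummerTempered.lean` for the
NON-ABELIAN compatible group `TateTowerKummerTwist.Compat` of abc-iut-L1-t6 (p472997).  DESIGN POINT: the level subgroups `Δ_n ∩ compat`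
(`closureC n`) have UNCOUNTABLE index (they force `c = 1`, and the constant-field factor of `compat` is `Ẑˣ`), so they cannot
witness [SemiAnbd] Def. 3.1 (i); instead ONE def + theorems:
* `vSub n` — `{γ = 1, k_i = 0, c_i = 1 (i < n)} ∩ compat`: an OPEN NORMAL subgroup (`vSub_normal`: the twist is coordinatewise and
  `Cst`, `ℤ_γ` are commutative; `isOpen_vSub`) of COUNTABLE index (`countable_quotient_vSub`: the coset of `g` is determined by its
  coordinates of index `< n` and `γ`), packaged as `vOpenNormal n : OpenNormalSubgroup Compat`;
* `exists_vSub_subset_of_isOpen` — every neighbourhood of `1` contains some `vSub n` (box argument in `K × C`, product topologies);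
* **`TateTowerKummerTwist.isTemperedC : IsTempered Compat`** — basis, separation, completeness (a compatible family of cosets is read
  off on the `vSub n`: translation from `n = 0`, coordinates of index `i` from `n = i+1`; the glued element is COMPATIBLE because the
  representatives are, `left_inv_mul` / `right_inv_mul`);
* **`baseRootLaw_galois_towerC_of_full_essSurj`** — abc-iut-L2-t3's `IG := «Galois»` form of A10
  (`baseRootLaw_galois_of_rootLaw_of_full_essSurj`) at the ζ-twisted tower with BOTH `hG := isTemperedC` and `hR := rootLawC`
  DISCHARGED, for every tempered Frobenioid over `ofRlfZWeak (ofTower towerC) hpf` with full essentially surjective base.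
HONEST FRAMING: a combinatorial consistency witness (class-(b) design model, NOT the tempered fundamental group of a Tate curve); nothing
here bears on [IUTchIII] Cor. 3.12; no side taken; typed ≠ proved.
-/

noncomputable section

namespace Literature.AnabelianGeometry.EtaleTheta

open CategoryTheory Opposite Function Topology Literature.AlgebraicGeometry.Frobenioids
  Literature.AlgebraicGeometry.Frobenioids.QuasiTemperoid Literature.AnabelianGeometry.SemiGraphs LogDivisorTower

namespace TateTowerKummerTwist

/-! ## §1 Coordinates of `a⁻¹ b` and the open normal subgroups `vSub n` -/

/-- Kummer coordinates of `a⁻¹ b`: `χ(a)⁻¹ · (k^b − k^a)`. [cite: MochizukiEtTh2009, §1 p.13] -/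
theorem left_inv_mul (a b : Grp) (i : ℕ) :
    (a⁻¹ * b).1.left.toAdd i = (a.1.right i)⁻¹ • (b.1.left.toAdd i - a.1.left.toAdd i) := by
  rw [toAdd_left_mul, toAdd_left_inv, Prod.fst_inv, SemidirectProduct.inv_right, Pi.inv_apply, ← smul_add, neg_add_eq_sub]

/-- Character coordinates of `a⁻¹ b`: `χ(a)⁻¹ χ(b)`. [cite: MochizukiEtTh2009, §1 p.13] -/
theorem right_inv_mul (a b : Grp) (i : ℕ) : (a⁻¹ * b).1.right i = (a.1.right i)⁻¹ * b.1.right i := by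
  rw [Prod.fst_mul, SemidirectProduct.mul_right, Prod.fst_inv, SemidirectProduct.inv_right, Pi.mul_apply, Pi.inv_apply]

/-- **`vSub n = {γ = 1, k_i = 0, c_i = 1 for i < n} ∩ compat`** — trivial translation and trivial coordinates (Kummer AND character)
of every index `< n`. [cite: MochizukiSemiAnbd2006, Def 3.1 (i) p.33] -/
def vSub (n : ℕ) : Subgroup Compat where
  carrier := {g | (g : Grp).2 = 1 ∧ ∀ i < n, (g : Grp).1.left.toAdd i = 0 ∧ (g : Grp).1.right i = 1}
  mul_mem' := by
    rintro a b ⟨ha2, ha⟩ ⟨hb2, hb⟩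
    refine ⟨by rw [Subgroup.coe_mul, Prod.snd_mul, ha2, hb2, mul_one], fun i hi => ⟨?_, ?_⟩⟩
    · rw [Subgroup.coe_mul, toAdd_left_mul, (ha i hi).1, (hb i hi).1, smul_zero, add_zero]
    · rw [Subgroup.coe_mul, Prod.fst_mul, SemidirectProduct.mul_right, Pi.mul_apply, (ha i hi).2, (hb i hi).2, mul_one]
  one_mem' := ⟨rfl, fun _ _ => ⟨rfl, rfl⟩⟩
  inv_mem' := by
    rintro a ⟨ha2, ha⟩
    refine ⟨by rw [Subgroup.coe_inv, Prod.snd_inv, ha2, inv_one], fun i hi => ⟨?_, ?_⟩⟩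
    · rw [Subgroup.coe_inv, toAdd_left_inv, (ha i hi).1, neg_zero, smul_zero]
    · rw [Subgroup.coe_inv, Prod.fst_inv, SemidirectProduct.inv_right, Pi.inv_apply, (ha i hi).2, inv_one]

/-- Membership in `vSub n`. [cite: MochizukiSemiAnbd2006, Def 3.1 (i) p.33] -/
theorem mem_vSub_iff (n : ℕ) (g : Compat) :
    g ∈ vSub n ↔ (g : Grp).2 = 1 ∧ ∀ i < n, (g : Grp).1.left.toAdd i = 0 ∧ (g : Grp).1.right i = 1 := Iff.rfl

/-- `a⁻¹ b ∈ vSub n` iff `a`, `b` have the same translation and the same coordinates of every index `< n`.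
[cite: MochizukiSemiAnbd2006, Def 3.1 (i) p.33] -/
theorem inv_mul_mem_vSub_iff (n : ℕ) (a b : Compat) :
    a⁻¹ * b ∈ vSub n ↔ (a : Grp).2 = (b : Grp).2 ∧
      ∀ i < n, (a : Grp).1.left.toAdd i = (b : Grp).1.left.toAdd i ∧ (a : Grp).1.right i = (b : Grp).1.right i := by
  rw [mem_vSub_iff, Subgroup.coe_mul, Subgroup.coe_inv, Prod.snd_mul, Prod.snd_inv, inv_mul_eq_one]
  refine and_congr Iff.rfl (forall_congr' fun i => forall_congr' fun _ => ?_)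
  rw [left_inv_mul, right_inv_mul, smul_eq_zero_iff_eq, sub_eq_zero, inv_mul_eq_one, eq_comm]

/-- The `vSub n` are nested. [cite: MochizukiSemiAnbd2006, Def 3.1 (i) p.33] -/
theorem vSub_antitone {n m : ℕ} (h : n ≤ m) : vSub m ≤ vSub n :=
  fun _ hg => ⟨hg.1, fun i hi => hg.2 i (lt_of_lt_of_le hi h)⟩

/-- **`vSub n` is NORMAL** (the twist acts coordinatewise; `C` and `ℤ_γ` are commutative). [cite: MochizukiSemiAnbd2006, Def 3.1 (i) p.33] -/
theorem vSub_normal (n : ℕ) : (vSub n).Normal := by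
  refine ⟨fun g hg h => ?_⟩
  obtain ⟨hg2, hgc⟩ := hg
  refine ⟨?_, fun i hi => ⟨?_, ?_⟩⟩
  · rw [Subgroup.coe_mul, Subgroup.coe_mul, Subgroup.coe_inv, Prod.snd_mul, Prod.snd_mul, Prod.snd_inv, hg2, mul_one,
      mul_inv_cancel]
  · rw [Subgroup.coe_mul, Subgroup.coe_mul, Subgroup.coe_inv, toAdd_left_mul, toAdd_left_mul, toAdd_left_inv, Prod.fst_mul,
      SemidirectProduct.mul_right, Pi.mul_apply, (hgc i hi).1, (hgc i hi).2, smul_zero, add_zero, mul_one, smul_smul,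
      mul_inv_cancel, one_smul, add_neg_cancel]
  · rw [Subgroup.coe_mul, Subgroup.coe_mul, Subgroup.coe_inv, Prod.fst_mul, Prod.fst_mul, Prod.fst_inv,
      SemidirectProduct.mul_right, SemidirectProduct.mul_right, SemidirectProduct.inv_right, Pi.mul_apply, Pi.mul_apply,
      Pi.inv_apply, (hgc i hi).2, mul_one, mul_inv_cancel]

/-- **`vSub n` is OPEN** (finitely many discrete coordinates and the discrete translation are constrained).
[cite: MochizukiSemiAnbd2006, Def 3.1 (i) p.33] -/
theorem isOpen_vSub (n : ℕ) : IsOpen (vSub n : Set Compat) := by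
  have h : (vSub n : Set Compat) = (fun g : Compat => (g : Grp).2) ⁻¹' {1} ∩
      ⋂ i ∈ Finset.range n, ((fun g : Compat => (g : Grp).1.left.toAdd i) ⁻¹' {0} ∩
        (fun g : Compat => ((g : Grp).1.right i : ZMod (M i))) ⁻¹' {1}) := by
    ext g
    simp only [Set.mem_inter_iff, Set.mem_iInter, Set.mem_preimage, Set.mem_singleton_iff, Finset.mem_range, Units.val_eq_one]
    rfl
  rw [h]
  exact ((isOpen_discrete _).preimage (continuous_snd.comp continuous_subtype_val)).inter
    (isOpen_biInter_finset fun i _ =>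
      ((isOpen_discrete _).preimage ((continuous_coordK i).comp continuous_subtype_val)).inter
        ((isOpen_discrete _).preimage (Units.continuous_val.comp ((continuous_coordC i).comp continuous_subtype_val))))

/-- **`Compat / vSub n` is COUNTABLE**: the coset of `g` is determined by its coordinates of index `< n` and its translation.
[cite: MochizukiSemiAnbd2006, Def 3.1 (i) p.33] -/
theorem countable_quotient_vSub (n : ℕ) : Countable (Compat ⧸ vSub n) := by
  haveI : ∀ i : Fin n, NeZero (M (i : ℕ)) := fun i => ⟨(Nat.factorial_pos _).ne'⟩
  let F : Compat → (∀ i : Fin n, (ZMod (M i) × ZMod (M i)) × ZMod (M i)) × Multiplicative ℤ :=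
    fun g => (fun i => ((g : Grp).1.left.toAdd i, ((g : Grp).1.right i : ZMod (M i))), (g : Grp).2)
  have hF : ∀ a b : Compat, a⁻¹ * b ∈ vSub n → F a = F b := fun a b hab => by
    obtain ⟨h2, hc⟩ := (inv_mul_mem_vSub_iff n a b).1 hab
    exact Prod.ext (funext fun i => Prod.ext (hc i i.2).1 (congrArg Units.val (hc i i.2).2)) h2
  refine Function.Injective.countable (f := fun q : Compat ⧸ vSub n => Quotient.liftOn' q F fun a b hab =>
    hF a b (QuotientGroup.leftRel_apply.1 hab)) fun q₁ q₂ hq => ?_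
  induction q₁ using QuotientGroup.induction_on with
  | H a =>
    induction q₂ using QuotientGroup.induction_on with
    | H b =>
      change F a = F b at hq
      obtain ⟨h1, h2⟩ := Prod.ext_iff.1 hq
      refine QuotientGroup.eq.2 ((inv_mul_mem_vSub_iff n a b).2 ⟨h2, fun i hi => ?_⟩)
      have hi' := congrFun h1 ⟨i, hi⟩
      obtain ⟨hk, hc⟩ := Prod.ext_iff.1 hi'
      exact ⟨hk, Units.ext hc⟩

/-- `vSub n` as an OPEN NORMAL subgroup of the compatible group. [cite: MochizukiSemiAnbd2006, Def 3.1 (i) p.33] -/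
def vOpenNormal (n : ℕ) : OpenNormalSubgroup Compat :=
  { toOpenSubgroup := ⟨vSub n, isOpen_vSub n⟩, isNormal' := vSub_normal n }

/-- Underlying subgroup of `vOpenNormal n`. [cite: MochizukiSemiAnbd2006, Def 3.1 (i) p.33] -/
theorem vOpenNormal_toSubgroup (n : ℕ) : (vOpenNormal n).toSubgroup = vSub n := rfl

/-! ## §2 Every neighbourhood of `1` contains some `vSub n` -/

/-- **Every open neighbourhood of `1` in `Compat` contains some `vSub n`** (the topology is induced from `(K × C) × ℤ_γ`, products of
discrete factors: an open set constrains finitely many coordinates). [cite: MochizukiSemiAnbd2006, Def 3.1 (i) p.33] -/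
theorem exists_vSub_subset_of_isOpen {U : Set Compat} (hU : IsOpen U) (h1 : (1 : Compat) ∈ U) :
    ∃ n, (vSub n : Set Compat) ⊆ U := by
  obtain ⟨s, hs, hsU⟩ := isOpen_induced_iff.mp hU
  let ι : KumAdd × Cst → Grp := fun p => ((⟨Multiplicative.ofAdd p.1, p.2⟩ : KC), 1)
  have hι : Continuous ι :=
    ((isInducing_leftRight.continuous_iff).2 ((continuous_ofAdd.comp continuous_fst).prodMk continuous_snd)).prodMk
      continuous_const
  have h0 : ((0 : KumAdd), (1 : Cst)) ∈ ι ⁻¹' s := by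
    have h1' : (1 : Compat) ∈ Subtype.val ⁻¹' s := by rw [hsU]; exact h1
    exact h1'
  obtain ⟨u₁, u₂, hu₁, hu₂, h01, h12, huu⟩ := isOpen_prod_iff.1 (hs.preimage hι) 0 1 h0
  obtain ⟨I, w, hw, hIw⟩ := isOpen_pi_iff.1 hu₁ 0 h01
  obtain ⟨J, w', hw', hJw⟩ := isOpen_pi_iff.1 hu₂ 1 h12
  refine ⟨max (I.sup id) (J.sup id) + 1, fun g hg => ?_⟩
  obtain ⟨hg2, hgc⟩ := hg
  have hgι : (g : Grp) = ι (Multiplicative.toAdd (g : Grp).1.left, (g : Grp).1.right) :=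
    Prod.ext (SemidirectProduct.ext (ofAdd_toAdd _).symm rfl) hg2
  have hmem : (Multiplicative.toAdd (g : Grp).1.left, (g : Grp).1.right) ∈ ι ⁻¹' s := by
    refine huu ⟨hIw fun a ha => ?_, hJw fun a ha => ?_⟩
    · have hlt : a < max (I.sup id) (J.sup id) + 1 :=
        Nat.lt_succ_of_le ((Finset.le_sup (f := id) ha).trans (le_max_left _ _))
      change (g : Grp).1.left.toAdd a ∈ w a
      rw [(hgc a hlt).1]
      exact (hw a ha).2
    · have hlt : a < max (I.sup id) (J.sup id) + 1 :=
        Nat.lt_succ_of_le ((Finset.le_sup (f := id) ha).trans (le_max_right _ _))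
      change (g : Grp).1.right a ∈ w' a
      rw [(hgc a hlt).2]
      exact (hw' a ha).2
  rw [← hsU]
  change (g : Grp) ∈ s
  rw [hgι]
  exact hmem

/-- Every open normal subgroup of `Compat` contains some `vSub n`. [cite: MochizukiSemiAnbd2006, Def 3.1 (i) p.33] -/
theorem exists_vOpenNormal_le (N : OpenNormalSubgroup Compat) : ∃ n, vOpenNormal n ≤ N := by
  obtain ⟨n, hn⟩ := exists_vSub_subset_of_isOpen N.toOpenSubgroup.isOpen N.toOpenSubgroup.one_mem
  exact ⟨n, fun g hg => hn hg⟩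

/-! ## §3 `Compat` is tempered -/

/-- **[SemiAnbd] Def. 3.1 (i): the compatible ζ-twisted Kummer–Tate group `Ẑ(1)² ⋊ Ẑˣ × ℤ_γ` is a TEMPERED group** — basis of open
normal subgroups of countable index (`vSub n`), separation, and completeness (`Compat = lim_n Compat/vSub n`: a compatible family of
cosets is read off coordinatewise — translation at `n = 0`, the index-`i` coordinates at `n = i+1` — and the glued element is
compatible because the representatives are). [cite: MochizukiSemiAnbd2006, Def 3.1 (i) p.33] -/
theorem isTemperedC : IsTempered Compat where
  basis U hU := by
    obtain ⟨V, hVU, hVo, h1V⟩ := mem_nhds_iff.mp hU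
    obtain ⟨n, hn⟩ := exists_vSub_subset_of_isOpen hVo h1V
    exact ⟨vOpenNormal n, countable_quotient_vSub n, hn.trans hVU⟩
  separated g hg := by
    by_cases h2 : (g : Grp).2 = 1
    · by_cases hk : ∃ i, ¬((g : Grp).1.left.toAdd i = 0 ∧ (g : Grp).1.right i = 1)
      · obtain ⟨i, hi⟩ := hk
        exact ⟨vOpenNormal (i + 1), fun hmem => hi (hmem.2 i (Nat.lt_succ_self i))⟩
      · simp only [not_exists, not_not] at hk
        exact absurd (Subtype.ext (Prod.ext (SemidirectProduct.ext
          (Multiplicative.toAdd.injective (funext fun i => (hk i).1)) (funext fun i => (hk i).2)) h2)) hg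
    · exact ⟨vOpenNormal 0, fun hmem => h2 hmem.1⟩
  complete x hx := by
    -- representatives modulo each `vSub n`
    have hr : ∀ n, ∃ r : Compat, (r : Compat ⧸ (vOpenNormal n).toSubgroup) = x (vOpenNormal n) :=
      fun n => QuotientGroup.mk_surjective _
    choose r hr using hr
    -- two representatives of compatible levels agree modulo the coarser `vSub`
    have hcompat : ∀ {n m : ℕ}, m ≤ n → (r m)⁻¹ * r n ∈ vSub m := by
      intro n m hmn
      have h1 : x (vOpenNormal m) = (r n : Compat ⧸ (vOpenNormal m).toSubgroup) :=
        hx (vOpenNormal n) (vOpenNormal m) (fun g hg => vSub_antitone hmn hg) (r n) (hr n).symm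
      rw [← hr m] at h1
      exact QuotientGroup.eq.1 h1
    -- the coordinates of index `i` stabilise from `n = i+1` on, the translation from `n = 0` on
    have hcoord : ∀ {i n : ℕ}, i < n →
        ((r n : Compat) : Grp).1.left.toAdd i = ((r (i + 1) : Compat) : Grp).1.left.toAdd i ∧
          ((r n : Compat) : Grp).1.right i = ((r (i + 1) : Compat) : Grp).1.right i := by
      intro i n hin
      obtain ⟨-, hc⟩ := (inv_mul_mem_vSub_iff _ _ _).1 (hcompat (Nat.succ_le_of_lt hin))
      exact ⟨(hc i (Nat.lt_succ_self i)).1.symm, (hc i (Nat.lt_succ_self i)).2.symm⟩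
    have hγ : ∀ n, ((r n : Compat) : Grp).2 = ((r 0 : Compat) : Grp).2 := fun n =>
      ((inv_mul_mem_vSub_iff _ _ _).1 (hcompat (Nat.zero_le n))).1.symm
    -- the glued element, compatible because the representatives are
    let g₀ : Grp := (⟨Multiplicative.ofAdd fun i => ((r (i + 1) : Compat) : Grp).1.left.toAdd i,
      fun i => ((r (i + 1) : Compat) : Grp).1.right i⟩, ((r 0 : Compat) : Grp).2)
    have hg₀ : g₀ ∈ compat := by
      refine ⟨fun i j h => ?_, fun i j h => ?_⟩
      · change resK h (((r (j + 1) : Compat) : Grp).1.left.toAdd j) = ((r (i + 1) : Compat) : Grp).1.left.toAdd i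
        rw [(r (j + 1)).2.1 i j h, (hcoord (Nat.lt_succ_of_le h)).1]
      · change resC h (((r (j + 1) : Compat) : Grp).1.right j) = ((r (i + 1) : Compat) : Grp).1.right i
        rw [(r (j + 1)).2.2 i j h, (hcoord (Nat.lt_succ_of_le h)).2]
    -- it represents `x` modulo every `vSub n` …
    have hglue : ∀ n, x (vOpenNormal n) = ((⟨g₀, hg₀⟩ : Compat) : Compat ⧸ (vOpenNormal n).toSubgroup) := by
      intro n
      rw [← hr n]
      refine QuotientGroup.eq.2 ((inv_mul_mem_vSub_iff n (r n) ⟨g₀, hg₀⟩).2 ⟨hγ n, fun i hi => ?_⟩)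
      exact ⟨(hcoord hi).1, (hcoord hi).2⟩
    -- … hence modulo every open normal subgroup
    refine ⟨⟨g₀, hg₀⟩, fun N => ?_⟩
    obtain ⟨n, hn⟩ := exists_vOpenNormal_le N
    exact hx (vOpenNormal n) N hn _ (hglue n)

/-! ## §4 The `IG := «Galois»` form of A10 over the ζ-twisted tower, `hG` and `hR` discharged -/

universe u₀ v₀

variable {hpf : ∀ Y : (ConnectedPart (BTemp Compat))ᵒᵖ, IsPerfFactorialCof ((DivisorMonoids.ofTower towerC).Φ₀.obj Y)}
  {D : Type u₀} [Category.{v₀} D] {VD : FrdICatStub.{u₀, v₀, 0} D}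

/-- **A10 `BaseRootLaw «Galois»` over the ζ-twisted Kummer–Tate tower, with E2 (a) AND temperedness discharged** (abc-iut-L2-t3's
`baseRootLaw_galois_of_rootLaw_of_full_essSurj` with `hG := isTemperedC`, `hR := rootLawC`), for every tempered Frobenioid over the
type-`ℤ` weak realified data of `ofTower towerC` whose base functor is full and essentially surjective.
[cite: MochizukiEtTh2009, Prop 4.2 (iii) p.89] -/
theorem baseRootLaw_galois_towerC_of_full_essSurj
    (tf : TemperedFrobenioid (RealifiedDivisorMonoids.ofRlfZWeak (DivisorMonoids.ofTower towerC) hpf) D VD)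
    [tf.base.Full] [tf.base.EssSurj] : tf.BaseRootLaw fun X => IsGaloisObj (tf.base.obj X).obj :=
  tf.baseRootLaw_galois_of_rootLaw_of_full_essSurj isTemperedC rootLawC

end TateTowerKummerTwist

end Literature.AnabelianGeometry.EtaleTheta

end
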